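import Literature.Computability.Cryptography.VanDamSeroussiOracleBQP
import Literature.Computability.Complexity.CodeFPListKit
import Summits.QuantumAdvantage.QuantumAdvantage.Theorems.MobiusLadderLiouvilleMemBQP
import Summits.QuantumAdvantage.QuantumAdvantage.Theses.TwoSquaresLadder

/-!
# Route `TwoSquaresLadder`: `TwoSquaresPostFP`, `TwoSquaresBitCorrect`, `TwoSquaresMemBQPOfSubs` and the crux
# `TwoSquaresMemBQP` — the language of sums of two squares is in `BQP`

Items stmt-QuantumAdvantage-17737 (`TwoSquaresPostFP`, crux r6), stmt-QuantumAdvantage-17738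
(`TwoSquaresBitCorrect`, crux r5), stmt-QuantumAdvantage-17739 (`TwoSquaresMemBQPOfSubs`, glue) and
stmt-QuantumAdvantage-16066 (`TwoSquaresMemBQP`, crux r9). This file follows the crux-strategist's line `split`
(Cruxes/TwoSquaresMemBQP/Lines/split.md, STRATEGY-CENSUS.md: all four stubs and the glue proved in the attached
candidate `TwoSquaresMemBQPComplete.lean`, "PROVER: land as Theorems/TwoSquaresLadderTwoSquaresMemBQP.lean") and
is VERBATIM the banked pattern `Theorems/MobiusLadderLiouvilleMemBQP.lean` (Shor + one classical wrap + read one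
wire) with the Fermat–Euler test on the factor list in place of the parity of `Ω(N)`:

* `codeFP_feAll` — the list test `F ↦ F.all (p ↦ ¬(p ≡ 3 mod 4) ∨ count p F even)` is polynomial time
  (`CodeFP.all` with the list itself as context, `CodeFP.rawCountNat`, `natMod`, `natEq`);
* `exists_post` / `twoSquaresPostFP_proof` — the post-processor `⟨x, code(F) ++ pad⟩ ↦ [x canonical ∧ test F]`
  is in `FP` (`VDSOracle.codeFP_parseF`, `parseF_certCode_append`, `codeFP_isCanonical` of MobiusLadder);
* `feAll_iff` / `twoSquaresBitCorrect_proof` — Fermat–Euler (Mathlib `Nat.eq_sq_add_sq_iff`: `N = a² + b²`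
  iff every prime `q ≡ 3 (4)` divides `N` to an even power) transported to the factor LIST
  (`Nat.primeFactorsList_count_eq`, `Nat.factorization_def`), `N = 0` included, and the canonical-numeral
  transfer;
* `TwoSquaresMemBQP_of_subs` (the glue, verbatim from the strategist's census Appendix B) and
  `TwoSquaresMemBQP_proof`: `factoring_mem_FBQP_holds` → `isQSolvable_classicalWrap_holds` →
  `mem_BQP_of_isQSolvable_bit`.

HONEST FRAMING: the value here is closed ledger items (kernel-checked), not summit progress — the
summit-strength binder of this route is `TwoSquaresNotBPP`, untouched.

References: P. W. Shor, SIAM J. Comput. 26 (1997) 1484–1509, §5 [Shor1997]; E. Bernstein, U. Vazirani, SIAM J.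
Comput. 26 (1997) 1411–1473, §8 [BernsteinVazirani1997]; Fermat–Euler two-squares theorem (Mathlib
`Nat.eq_sq_add_sq_iff`).
-/

set_option linter.dupNamespace false -- D-0017: single-problem summit ⇒ `QuantumAdvantage.QuantumAdvantage` by design

namespace Summit.QuantumAdvantage.QuantumAdvantage.Theorems.TwoSquaresLadder

open _root_.Computability
open Literature.Computability.Complexity Literature.Computability.Cryptography
open Literature.Computability.Complexity.Brick Literature.Computability.Complexity.CodeFP
open Summit.QuantumAdvantage.QuantumAdvantage.Theorems.MobiusLadder (codeFP_isCanonical)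

/-! ### The Fermat–Euler test on a factor list is polynomial time -/

/-- The Fermat–Euler test on a list of naturals: every entry `≡ 3 (mod 4)` occurs an even number of times. -/
private theorem feAll_def (F : List ℕ) :
    F.all (fun p => !decide (p % 4 = 3) || decide (F.count p % 2 = 0)) =
      F.all (fun a => (fun q : List ℕ × ℕ => !decide (q.2 % 4 = 3) || decide (q.1.count q.2 % 2 = 0)) (F, a)) :=
  rfl

/-- `fstF` on strings. [folklore] -/
private theorem codeFP_fstF : CodeFP strE strE fstF := ⟨fstF, fstF_mem_FP, fun _ => rfl⟩

/-- `sndF` on strings. [folklore] -/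
private theorem codeFP_sndF : CodeFP strE strE sndF := ⟨sndF, sndF_mem_FP, fun _ => rfl⟩

/-- **The Fermat–Euler list test is polynomial time**: `F ↦ F.all (p ↦ ¬(p % 4 = 3) ∨ count p F % 2 = 0)`
(`CodeFP.all` with the list itself threaded as the context; `rawCountNat`, `natMod`, `natEq`).
[cite: AroraBarak2009, §1.3] [folklore] -/
theorem codeFP_feAll :
    CodeFP (rawE natE) bitE (fun F : List ℕ => F.all (fun p => !decide (p % 4 = 3) || decide (F.count p % 2 = 0))) := by
  -- the predicate with context: `(F, a) ↦ ¬(a % 4 = 3) ∨ count a F % 2 = 0`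
  have hmod3 : CodeFP (pairE (rawE natE) natE) bitE (fun q : List ℕ × ℕ => decide (q.2 % 4 = 3)) :=
    (natEq.comp ((natMod.comp ((snd _ _).pair (const _ 4))).pair (const _ 3))).congr fun _ => rfl
  have hcnt : CodeFP (pairE (rawE natE) natE) natE (fun q : List ℕ × ℕ => q.1.count q.2) :=
    (rawCountNat.comp ((snd _ _).pair (fst _ _))).congr fun _ => rfl
  have heven : CodeFP (pairE (rawE natE) natE) bitE (fun q : List ℕ × ℕ => decide (q.1.count q.2 % 2 = 0)) :=
    (natEq.comp ((natMod.comp (hcnt.pair (const _ 2))).pair (const _ 0))).congr fun _ => rfl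
  have hP : CodeFP (pairE (rawE natE) natE) bitE
      (fun q : List ℕ × ℕ => !decide (q.2 % 4 = 3) || decide (q.1.count q.2 % 2 = 0)) :=
    (hmod3.not.or heven).congr fun _ => rfl
  exact ((all hP).comp ((CodeFP.id (rawE natE)).pair (CodeFP.id (rawE natE)))).congr fun F => by
    rw [feAll_def]; rfl

/-- **The post-processor is polynomial time**: on `v = ⟨x, y⟩`,
`[x is a canonical numeral ∧ the parsed factor list of y passes the Fermat–Euler test]`. [folklore] -/
theorem codeFP_post : CodeFP strE bitE (fun v =>
    decide (encodeNat (bitsToNat (fstF v)) = fstF v) &&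
      (VDSOracle.parseF (sndF v)).all (fun p => !decide (p % 4 = 3) ||
        decide ((VDSOracle.parseF (sndF v)).count p % 2 = 0))) := by
  have h1 := codeFP_isCanonical.comp codeFP_fstF
  have h2 := codeFP_feAll.comp (VDSOracle.codeFP_parseF.comp codeFP_sndF)
  exact (h1.and h2).congr fun _ => rfl

/-- The post-processor as an `FP` string function with its value on pairs. [folklore] -/
theorem exists_post : ∃ g ∈ FP, ∀ x y : List Bool, g (boolPair x y) =
    [decide (encodeNat (bitsToNat x) = x) &&
      (VDSOracle.parseF y).all (fun p => !decide (p % 4 = 3) || decide ((VDSOracle.parseF y).count p % 2 = 0))] := by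
  obtain ⟨g, hg, h⟩ := codeFP_post
  refine ⟨g, hg, fun x y => ?_⟩
  have := h (boolPair x y)
  simp only [fstF_boolPair, sndF_boolPair] at this
  exact this

/-- **`TwoSquaresPostFP`** (stmt-QuantumAdvantage-17737): the post-processor
`⟨x, code(F) ++ pad⟩ ↦ [x canonical ∧ F passes the Fermat–Euler test]` is in `FP` (the list code is
self-delimiting: `parseF (certCode F ++ pad) = F`). [cite: BernsteinVazirani1997, §8] [folklore] -/
theorem twoSquaresPostFP_proof :
    Summit.QuantumAdvantage.QuantumAdvantage.Theses.TwoSquaresLadder.TwoSquaresPostFP := by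
  unfold Summit.QuantumAdvantage.QuantumAdvantage.Theses.TwoSquaresLadder.TwoSquaresPostFP
  obtain ⟨g, hg, hpost⟩ := exists_post
  refine ⟨g, hg, fun x F pad => ?_⟩
  rw [VDSOracle.encode_primeFactorsList_eq, hpost, VDSOracle.parseF_certCode_append]

/-! ### The answer bit decides `L(S₂)` -/

/-- **Fermat–Euler on the factor list**: the test `∀ p ∈ primeFactorsList N, p ≡ 3 (4) → count p even` holds iff
`N` is a sum of two squares (Mathlib `Nat.eq_sq_add_sq_iff`; `N = 0 = 0² + 0²` passes with the empty list).
[folklore] -/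
theorem feAll_iff (N : ℕ) :
    N.primeFactorsList.all (fun p => !decide (p % 4 = 3) || decide (N.primeFactorsList.count p % 2 = 0)) = true ↔
      ∃ a b : ℕ, N = a ^ 2 + b ^ 2 := by
  rw [Nat.eq_sq_add_sq_iff, List.all_eq_true]
  constructor
  · intro h q hq hq3
    have hq' : q ∈ N.primeFactorsList := Nat.mem_primeFactors_iff_mem_primeFactorsList.1 hq
    have hqp : q.Prime := Nat.prime_of_mem_primeFactorsList hq'
    have := h q hq'
    simp only [hq3, decide_true, Bool.not_true, Bool.false_or, decide_eq_true_eq] at this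
    rw [Nat.primeFactorsList_count_eq, Nat.factorization_def N hqp] at this
    exact Nat.even_iff.2 this
  · intro h q hq
    rw [Bool.or_eq_true, Bool.not_eq_true', decide_eq_false_iff_not, decide_eq_true_eq]
    by_cases hq3 : q % 4 = 3
    · right
      have hqp : q.Prime := Nat.prime_of_mem_primeFactorsList hq
      rw [Nat.primeFactorsList_count_eq, Nat.factorization_def N hqp]
      exact Nat.even_iff.1 (h q (Nat.mem_primeFactors_iff_mem_primeFactorsList.2 hq) hq3)
    · left
      exact hq3

/-- **`TwoSquaresBitCorrect`** (stmt-QuantumAdvantage-17738): the answer bit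
`[x canonical ∧ Fermat–Euler test on primeFactorsList (decodeNat x)]` is `true` iff
`x ∈ encodingNatBool.toLanguage {N | ∃ a b, N = a² + b²}`. [folklore] -/
theorem twoSquaresBitCorrect_proof :
    Summit.QuantumAdvantage.QuantumAdvantage.Theses.TwoSquaresLadder.TwoSquaresBitCorrect := by
  unfold Summit.QuantumAdvantage.QuantumAdvantage.Theses.TwoSquaresLadder.TwoSquaresBitCorrect
  intro x
  change _ ↔ x ∈ encodingNatBool.encode '' {N : ℕ | ∃ a b : ℕ, N = a ^ 2 + b ^ 2}
  rw [Set.mem_image, Bool.and_eq_true, decide_eq_true_eq]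
  constructor
  · rintro ⟨hcanon, hfe⟩
    have hdec : decodeNat x = bitsToNat x := by
      conv_lhs => rw [← hcanon]
      exact decode_encodeNat _
    rw [hdec] at hfe
    exact ⟨bitsToNat x, (feAll_iff _).1 hfe, hcanon⟩
  · rintro ⟨N, hN, rfl⟩
    rw [Set.mem_setOf_eq, ← feAll_iff] at hN
    have e : (encodingNatBool.encode N : List Bool) = encodeNat N := rfl
    refine ⟨?_, ?_⟩
    · rw [e, bitsToNat_encodeNat]
    · rw [e, decode_encodeNat]
      exact hN

/-! ### The language is in `BQP` -/

/-- **The glue `TwoSquaresMemBQPOfSubs`** (stmt-QuantumAdvantage-17739), with its two antecedents as hypotheses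
(verbatim the crux-strategist's `TwoSquaresMemBQP_of_subs`, STRATEGY-CENSUS.md Appendix B): Shor's theorem in
search form (`factoring_mem_FBQP_holds`), one classical wrap with the post-processor of X₁
(`isQSolvable_classicalWrap_holds`), the wrapped family writes the answer bit first, and X₂ says that bit is
membership in `L(S₂)` (`mem_BQP_of_isQSolvable_bit`). [cite: Shor1997, §5] [cite: BernsteinVazirani1997, §8] -/
theorem TwoSquaresMemBQP_of_subs
    (h₁ : Summit.QuantumAdvantage.QuantumAdvantage.Theses.TwoSquaresLadder.TwoSquaresPostFP)
    (h₂ : Summit.QuantumAdvantage.QuantumAdvantage.Theses.TwoSquaresLadder.TwoSquaresBitCorrect) :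
    Summit.QuantumAdvantage.QuantumAdvantage.Theses.TwoSquaresLadder.TwoSquaresMemBQP := by
  obtain ⟨g, hg, hpost⟩ := h₁
  unfold Summit.QuantumAdvantage.QuantumAdvantage.Theses.TwoSquaresLadder.TwoSquaresMemBQP
  -- Shor's theorem in search form (discharged in the tree): the factor list is written with probability ≥ 2/3
  have hF : IsQSolvable fun x =>
      {y : List Bool | encodingListNatBool.encode (decodeNat x).primeFactorsList <+: y} :=
    factoring_mem_FBQP_holds
  -- one classical wrap: identity pre-processor, the `FP` post-processor `g` of X₁
  have hW := isQSolvable_classicalWrap_holds (fun x : List Bool => x) g (PolyTimeComputable.id _) hg hF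
  -- the wrapped family writes the answer bit first
  have hbit : IsQSolvable fun x => {z |
      [decide (encodeNat (bitsToNat x) = x) &&
        (decodeNat x).primeFactorsList.all (fun p => !decide (p % 4 = 3) ||
          decide ((decodeNat x).primeFactorsList.count p % 2 = 0))] <+: z} := by
    refine hW.mono fun x z hz => ?_
    obtain ⟨y, hy, hz⟩ := hz
    simp only [Set.mem_setOf_eq] at hy
    obtain ⟨pad, rfl⟩ := hy
    rw [hpost] at hz
    exact hz
  -- decision from search: read wire 0; X₂ says the bit is membership in L(S₂)
  exact mem_BQP_of_isQSolvable_bit (fun _ _ => QCircuit.outputPMF_apply_holds) cliffordT_isUnitary_holds h₂ hbit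

/-- **`TwoSquaresMemBQPOfSubs`** (stmt-QuantumAdvantage-17739) by name. [cite: Shor1997, §5] -/
theorem twoSquaresMemBQPOfSubs_proof :
    Summit.QuantumAdvantage.QuantumAdvantage.Theses.TwoSquaresLadder.TwoSquaresMemBQPOfSubs := by
  unfold Summit.QuantumAdvantage.QuantumAdvantage.Theses.TwoSquaresLadder.TwoSquaresMemBQPOfSubs
  exact TwoSquaresMemBQP_of_subs

/-- Settles stmt-QuantumAdvantage-16066 (route TwoSquaresLadder, crux `TwoSquaresMemBQP`): **the language of sums
of two squares `{bin(N) : N = a² + b²}` is in `BQP`** (Shor + Fermat–Euler; GRH-free, unconditional).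
[cite: Shor1997, §5] -/
theorem TwoSquaresMemBQP_proof :
    Summit.QuantumAdvantage.QuantumAdvantage.Theses.TwoSquaresLadder.TwoSquaresMemBQP :=
  TwoSquaresMemBQP_of_subs twoSquaresPostFP_proof twoSquaresBitCorrect_proof

end Summit.QuantumAdvantage.QuantumAdvantage.Theorems.TwoSquaresLadder
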